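import Summits.QuantumFields.YangMills.Theorems.AtomicCalibrationRMassInputs
import Summits.QuantumFields.YangMills.Theorems.AtomicCalibrationRBandBridge
import Summits.QuantumFields.YangMills.Theorems.AtomicCalibrationRShellSum

/-!
# AtomicCalibrationR (stmt-QuantumFields-28169), E2 `stub_offDiagonalWhitney` — the mass of the far level of construction (T)
# (roadmap v2 item B.2'; prover w4 g22, free hands)

Companion of `AtomicCalibrationRLevelMass.level_mass` for the far pieces `P_c = G · (pairCut 0 · gridBump φ n h c)`:
no flatness, every cube may be alive, so the count is that of ALL cubes per unit shell (`≤ (3/h)^{4n} (2+a)^{4n}`) and the decay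
exponent is `k' = 4n + 2`:

* `card_intBox`, `ncard_shell_le` — `#{c | ⌊‖centre‖⌋₊ = a} ≤ (3/h)^{4n} (2+a)^{4n}` (`0 < h ≤ 1`);
* `far_level_mass` — weights `M c ≥ 0` with `‖D^m P_c(z)‖ ≤ M c/(2h)^m` (`m ≤ N₁`), `Summable M`,
  `Σ' M ≤ 2^{4n+1} (3/h)^{4n} B₀`, `B₀ = 2^{max k' N₁} 2^{k'} ‖F‖_{max k' N₁} max(1, 2h(1+R))^{N₁}`.

No stub/crux/rung/summit is closed; nothing here touches Yang–Mills; the YM mass gap is NOT proved. [folklore]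
-/

set_option autoImplicit false

noncomputable section

open scoped BigOperators ContDiff
open Set Metric Function
open Summit.QuantumFields.YangMills.Cruxes.AtomicCalibrationR.PairCutoff (pairCut)
open Summit.QuantumFields.YangMills.Cruxes.AtomicCalibrationR.GridPartition (gridBump gridCentre)
open Summit.QuantumFields.YangMills.Cruxes.AtomicCalibrationR.MassInputs (norm_iteratedFDeriv_farPiece_uniform_le)
open Summit.QuantumFields.YangMills.Cruxes.AtomicCalibrationR.BandCount (intBox)
open Summit.QuantumFields.YangMills.Cruxes.AtomicCalibrationR.BandBridge (abs_int_le_of_norm_gridCentre_le two_mul_ceil_add_one_le)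
open Summit.QuantumFields.YangMills.Cruxes.AtomicCalibrationR.ShellSum (summable_of_shell_count tsum_le_of_shell_count)
open Literature.MathematicalPhysics.QuantumLattice (schwartzNorm schwartzNorm_nonneg schwartzNorm_mono)

namespace Summit.QuantumFields.YangMills.Cruxes.AtomicCalibrationR.FarLevelMass

variable {n : ℕ}

/-- `#intBox n R = (2R+1)^{4n}`. -/
theorem card_intBox (n R : ℕ) : (intBox n R).card = (2 * R + 1) ^ (4 * n) := by
  have hIcc : (Finset.Icc (-(R : ℤ)) R).card = 2 * R + 1 := by rw [Int.card_Icc]; omega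
  rw [intBox, Fintype.card_piFinset, Finset.prod_const, hIcc, Finset.card_univ, Fintype.card_prod, Fintype.card_fin,
    Fintype.card_fin, Nat.mul_comm n 4]

/-- Cubes with centre in `‖·‖ ≤ r` have their index in `intBox n ⌈r/h⌉₊`. -/
theorem mem_intBox_of_norm_le {h : ℝ} (hh : 0 < h) (c : Fin n × Fin 4 → ℤ) {r : ℝ} (hr : ‖gridCentre n h c‖ ≤ r) :
    c ∈ intBox n ⌈r / h⌉₊ := by
  rw [intBox, Fintype.mem_piFinset]
  intro q
  have hq := (abs_int_le_of_norm_gridCentre_le hh c hr q).trans (Nat.le_ceil (r / h))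
  have hq' : |c q| ≤ (⌈r / h⌉₊ : ℤ) := by exact_mod_cast hq
  exact Finset.mem_Icc.2 (abs_le.1 hq')

/-- **All cubes per unit shell**: `#{c | ⌊‖centre‖⌋₊ = a} ≤ (3/h)^{4n} (2+a)^{4n}` for `0 < h ≤ 1` (and the set is finite). -/
theorem ncard_shell_le {h : ℝ} (hh : 0 < h) (hh1 : h ≤ 1) (a : ℕ) :
    {c : Fin n × Fin 4 → ℤ | ⌊‖gridCentre n h c‖⌋₊ = a}.Finite ∧
      (({c : Fin n × Fin 4 → ℤ | ⌊‖gridCentre n h c‖⌋₊ = a}.ncard : ℕ) : ℝ) ≤ (3 / h) ^ (4 * n) * (2 + a) ^ (4 * n) := by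
  have hsub : {c : Fin n × Fin 4 → ℤ | ⌊‖gridCentre n h c‖⌋₊ = a} ⊆ ↑(intBox n ⌈((a : ℝ) + 1) / h⌉₊) := by
    intro c hc
    refine mem_intBox_of_norm_le hh c ?_
    have := Nat.lt_floor_add_one (‖gridCentre n h c‖)
    rw [show ⌊‖gridCentre n h c‖⌋₊ = a from hc] at this
    exact_mod_cast this.le
  refine ⟨(Finset.finite_toSet _).subset hsub, ?_⟩
  have h1 := Set.ncard_le_ncard hsub (Finset.finite_toSet _)
  rw [Set.ncard_coe_finset, card_intBox] at h1
  have h2 : (({c : Fin n × Fin 4 → ℤ | ⌊‖gridCentre n h c‖⌋₊ = a}.ncard : ℕ) : ℝ) ≤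
      ((2 * ⌈((a : ℝ) + 1) / h⌉₊ + 1 : ℕ) : ℝ) ^ (4 * n) := by exact_mod_cast h1
  refine h2.trans ?_
  push_cast
  have hc := two_mul_ceil_add_one_le hh hh1 a
  calc ((2 : ℝ) * ⌈((a : ℝ) + 1) / h⌉₊ + 1) ^ (4 * n) ≤ (3 * (2 + a) / h) ^ (4 * n) :=
        pow_le_pow_left₀ (by positivity) hc _
    _ = (3 / h) ^ (4 * n) * (2 + a) ^ (4 * n) := by rw [show (3 : ℝ) * (2 + a) / h = 3 / h * (2 + a) by ring, mul_pow]

/-- **Mass of the far level** (clauses (v) + (vi) for the far pieces).  See the module docstring. [folklore] -/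
theorem far_level_mass (F : SchwartzMap (Fin n → EuclideanSpace ℝ (Fin 4)) ℂ)
    {G : (Fin n → EuclideanSpace ℝ (Fin 4)) → ℝ} (hG : ContDiff ℝ ∞ G)
    (hGF : ∀ (j : ℕ) (w : Fin n → EuclideanSpace ℝ (Fin 4)), ‖iteratedFDeriv ℝ j G w‖ ≤ ‖iteratedFDeriv ℝ j F w‖)
    {φ : ℝ → ℝ} (hφ : ContDiff ℝ ∞ φ) (hφs : tsupport φ ⊆ Icc (-1 : ℝ) 1) {h : ℝ} (hh : 0 < h) (hh2 : 2 * h ≤ 1 / 2)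
    (N₁ : ℕ) {R : ℝ} (hR : 0 ≤ R)
    (hb : ∀ (c : Fin n × Fin 4 → ℤ) (z : Fin n → EuclideanSpace ℝ (Fin 4)) (i : ℕ), i ≤ N₁ →
      ‖iteratedFDeriv ℝ i (fun w => pairCut n 0 w * gridBump φ n h c w) z‖ ≤ R ^ i) :
    ∃ M : (Fin n × Fin 4 → ℤ) → ℝ, (∀ c, 0 ≤ M c) ∧ Summable M ∧
      ∑' c, M c ≤ 2 ^ (4 * n + 1) * (3 / h) ^ (4 * n) *
        (2 ^ max (4 * n + 2) N₁ * 2 ^ (4 * n + 2) * schwartzNorm (max (4 * n + 2) N₁) F *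
          max 1 (2 * h * (1 + R)) ^ N₁) ∧
      ∀ (c : Fin n × Fin 4 → ℤ) (m : ℕ), m ≤ N₁ → ∀ z : Fin n → EuclideanSpace ℝ (Fin 4),
        ‖iteratedFDeriv ℝ m (fun w => G w * (pairCut n 0 w * gridBump φ n h c w)) z‖ ≤ M c / (2 * h) ^ m := by
  classical
  set k' : ℕ := 4 * n + 2 with hk'
  set B : ℝ := 2 ^ max k' N₁ * 2 ^ k' * schwartzNorm (max k' N₁) F * max 1 (2 * h * (1 + R)) ^ N₁ with hB
  have hS : 0 ≤ schwartzNorm (max k' N₁) F := schwartzNorm_nonneg _ _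
  have hB0 : 0 ≤ B := by positivity
  have hh1 : h ≤ 1 := by linarith
  have h2h : 0 < 2 * h := by linarith
  let M : (Fin n × Fin 4 → ℤ) → ℝ := fun c => B / (1 + ‖gridCentre n h c‖) ^ k'
  have hM0 : ∀ c, 0 ≤ M c := fun c => by positivity
  have hMle : ∀ c, M c ≤ B / (1 + ‖gridCentre n h c‖) ^ (4 * n + 2) := fun c => le_rfl
  have hfin : ∀ a : ℕ, {c : Fin n × Fin 4 → ℤ | ⌊‖gridCentre n h c‖⌋₊ = a}.Finite := fun a => (ncard_shell_le hh hh1 a).1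
  have hcount : ∀ a : ℕ, (({c : Fin n × Fin 4 → ℤ | ⌊‖gridCentre n h c‖⌋₊ = a}.ncard : ℕ) : ℝ) ≤
      (3 / h) ^ (4 * n) * (2 + a) ^ (4 * n) := fun a => (ncard_shell_le hh hh1 a).2
  have hA0 : (0 : ℝ) ≤ (3 / h) ^ (4 * n) := by positivity
  refine ⟨M, hM0, ?_, ?_, ?_⟩
  · exact summable_of_shell_count (fun c => ‖gridCentre n h c‖) M (fun c => norm_nonneg _) hM0 hA0 hB0 hfin hcount hMle
  · have := tsum_le_of_shell_count (fun c => ‖gridCentre n h c‖) M (fun c => norm_nonneg _) hM0 hA0 hB0 hfin hcount hMle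
    exact this
  · intro c m hm z
    have h1 := norm_iteratedFDeriv_farPiece_uniform_le F hG hGF hφ hφs hh hh2 c k' m hR (fun z i hi => hb c z i (hi.trans hm)) z
    refine h1.trans (div_le_div_of_nonneg_right ?_ (by positivity))
    -- monotonicity in `m`
    have hle : max k' m ≤ max k' N₁ := max_le_max le_rfl hm
    have h2pow : (2 : ℝ) ^ max k' m ≤ 2 ^ max k' N₁ := pow_le_pow_right₀ (by norm_num) hle
    have hSm : schwartzNorm (max k' m) F ≤ schwartzNorm (max k' N₁) F := schwartzNorm_mono hle F
    have hSm0 : 0 ≤ schwartzNorm (max k' m) F := schwartzNorm_nonneg _ _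
    have hpow2 : (2 * h * (1 + R)) ^ m ≤ max 1 (2 * h * (1 + R)) ^ N₁ :=
      (pow_le_pow_left₀ (by positivity) (le_max_right _ _) m).trans (pow_le_pow_right₀ (le_max_left _ _) hm)
    have hden : 0 < (1 + ‖gridCentre n h c‖) ^ k' := by positivity
    show 2 ^ max k' m * 2 ^ k' * schwartzNorm (max k' m) F / (1 + ‖gridCentre n h c‖) ^ k' * (2 * h * (1 + R)) ^ m ≤
      B / (1 + ‖gridCentre n h c‖) ^ k'
    rw [hB, div_mul_eq_mul_div, div_le_div_iff_of_pos_right hden]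
    calc 2 ^ max k' m * 2 ^ k' * schwartzNorm (max k' m) F * (2 * h * (1 + R)) ^ m
        ≤ 2 ^ max k' N₁ * 2 ^ k' * schwartzNorm (max k' N₁) F * max 1 (2 * h * (1 + R)) ^ N₁ := by
          refine mul_le_mul (mul_le_mul (mul_le_mul_of_nonneg_right h2pow (by positivity)) hSm hSm0 (by positivity))
            hpow2 (by positivity) (by positivity)

end Summit.QuantumFields.YangMills.Cruxes.AtomicCalibrationR.FarLevelMass

end
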